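import Mathlib.Analysis.SpecialFunctions.Pow.Real
import HarnessLib

/-!
# S2β · c₁ column — «THE PER-LEVEL CHART WINDOWS FROM THE PROFILES»: the displayed window letters `hwin : ∀ i < k, 100·ℓ·(κ_i + (κ_i + L^{k−i}·(2ε_i + δ_i))) ≤ ρ` of ✓p840777 ∕ ✓p840940 ∕
# w4 g29's (g2) follow from ONE smallness inequality per level, `100·ℓ·((2·Dm·Cδ + (2·Cε + Cδ))·θ_k) ≤ ρ` (`θ_k = L^{2k}·q`), under the one-power profiles `δ_i ≤ Cδ·L^{2i}·q`,
# `ε_i ≤ Cε·L^{2i}·q` — pure real arithmetic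

Cell `ym3-torus` (YM ladder rung R3 = continuum `SU(2)` Yang–Mills on the three-torus at fixed lattice data — a RUNG: NOT d = 4, NOT infinite volume, NOT a mass gap,
NOT Clay).  Width seat «width 12» `ym3-torus-px12` (gen 27); crux `stmt-QuantumFields-20520`, LINE g18-1 S2β, c₁ column.  `--kind proof --supports stmt-QuantumFields-20520 --as helper`,
count-neutral, DEFINITION-FREE (0 `def`, 0 `instance`, 0 `notation`, 0 `sorry`, default heartbeats).  No lattice object (`Dm := (d−1)·2L`, `ℓ := (d+2)L` at the dock; real powers).

WHAT IS PROVED (sorry-free).  `pow_two_mul_le_of_le` (`L^{2i} ≤ L^{2k}`, `i ≤ k`, `1 ≤ L`), `pow_sub_mul_pow_le` (`L^{k−i}·L^{2i} ≤ L^{2k}`), ★★★**`windows_of_profiles`** — for `i < k`: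
`100·(ℓ·(Dm·δ_i + (Dm·δ_i + L^{k−i}·(2·ε_i + δ_i)))) ≤ ρ` from `100·(ℓ·((2·Dm·Cδ + (2·Cε + Cδ))·(L^{2k}·q))) ≤ ρ`.

HONEST SCOPE.  Arithmetic; nothing of Bałaban's renormalisation-group analysis proved; the profiles (BKG class, line recursion ✓`…CurvatureRecursionLeast`) and the level-`k` smallness are HYPOTHESES; GAP♯∘
(`stub_uniformFibreGapOrbit`, registry 3732b7df UNTOUCHED, 0∕5), the five registered stubs, S2β, crux 20520, 19936, 19200, `YM3TorusSU2` — NOT proved; rung R3 — NOT d = 4, NOT infinite volume, NOT a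
mass gap, NOT Clay; the Yang–Mills mass gap is NOT proved.
-/

set_option autoImplicit false

namespace Summit.QuantumFields.YangMills.Theorems.FluctuationComparisonRegPrIntLS2BetaWindowsOfProfiles

/-- `L^{2i} ≤ L^{2k}` for `i ≤ k`, `1 ≤ L`. [folklore] -/
theorem pow_two_mul_le_of_le {L : ℝ} (hL : 1 ≤ L) {i k : ℕ} (hik : i ≤ k) : L ^ (2 * i) ≤ L ^ (2 * k) :=
  pow_le_pow_right₀ hL (by omega)

/-- `L^{k−i}·L^{2i} ≤ L^{2k}` for `i ≤ k`, `1 ≤ L`. [folklore] -/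
theorem pow_sub_mul_pow_le {L : ℝ} (hL : 1 ≤ L) {i k : ℕ} (hik : i ≤ k) : L ^ (k - i) * L ^ (2 * i) ≤ L ^ (2 * k) := by
  rw [← pow_add]
  exact pow_le_pow_right₀ hL (by omega)

/-- ★★★ **THE PER-LEVEL CHART WINDOWS FROM THE PROFILES**: for `i < k`, `100·(ℓ·(Dm·δ_i + (Dm·δ_i + L^{k−i}·(2·ε_i + δ_i)))) ≤ ρ` follows from the one-power profiles of `δ, ε`
and the single smallness `100·(ℓ·((2·Dm·Cδ + (2·Cε + Cδ))·(L^{2k}·q))) ≤ ρ`. [folklore] -/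
theorem windows_of_profiles {L q ρ ℓℓ Dm Cδ Cε : ℝ} (hL : 1 ≤ L) (hq : 0 ≤ q) (hℓℓ : 0 ≤ ℓℓ) (hDm : 0 ≤ Dm) (hCδ : 0 ≤ Cδ) (hCε : 0 ≤ Cε)
    (k : ℕ) (δ ε : ℕ → ℝ)
    (hδp : ∀ i, i ≤ k → 0 ≤ δ i ∧ δ i ≤ Cδ * L ^ (2 * i) * q) (hεp : ∀ i, i ≤ k → 0 ≤ ε i ∧ ε i ≤ Cε * L ^ (2 * i) * q)
    (hsmall : 100 * (ℓℓ * ((2 * Dm * Cδ + (2 * Cε + Cδ)) * (L ^ (2 * k) * q))) ≤ ρ) :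
    ∀ i, i < k → 100 * (ℓℓ * (Dm * δ i + (Dm * δ i + L ^ (k - i) * (2 * ε i + δ i)))) ≤ ρ := by
  intro i hi
  obtain ⟨hδ0, hδi⟩ := hδp i hi.le
  obtain ⟨hε0, hεi⟩ := hεp i hi.le
  have hL0 : 0 ≤ L := by linarith
  have hp2 := pow_two_mul_le_of_le hL hi.le
  have hpk := pow_sub_mul_pow_le hL hi.le
  have hLki : 0 ≤ L ^ (k - i) := pow_nonneg hL0 _
  -- `Dm·δ_i ≤ Dm·Cδ·θ_k`
  have h1 : Dm * δ i ≤ Dm * Cδ * (L ^ (2 * k) * q) := by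
    have : δ i ≤ Cδ * L ^ (2 * k) * q := hδi.trans (by nlinarith [mul_le_mul_of_nonneg_left hp2 hCδ])
    nlinarith
  -- `L^{k−i}·(2ε_i + δ_i) ≤ (2Cε + Cδ)·θ_k`
  have h2 : L ^ (k - i) * (2 * ε i + δ i) ≤ (2 * Cε + Cδ) * (L ^ (2 * k) * q) := by
    have h21 : 2 * ε i + δ i ≤ (2 * Cε + Cδ) * L ^ (2 * i) * q := by nlinarith
    calc L ^ (k - i) * (2 * ε i + δ i) ≤ L ^ (k - i) * ((2 * Cε + Cδ) * L ^ (2 * i) * q) := mul_le_mul_of_nonneg_left h21 hLki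
      _ = (2 * Cε + Cδ) * q * (L ^ (k - i) * L ^ (2 * i)) := by ring
      _ ≤ (2 * Cε + Cδ) * q * L ^ (2 * k) := mul_le_mul_of_nonneg_left hpk (by positivity)
      _ = (2 * Cε + Cδ) * (L ^ (2 * k) * q) := by ring
  have h3 : Dm * δ i + (Dm * δ i + L ^ (k - i) * (2 * ε i + δ i)) ≤ (2 * Dm * Cδ + (2 * Cε + Cδ)) * (L ^ (2 * k) * q) := by nlinarith
  exact le_trans (by nlinarith [mul_le_mul_of_nonneg_left h3 hℓℓ]) hsmall

end Summit.QuantumFields.YangMills.Theorems.FluctuationComparisonRegPrIntLS2BetaWindowsOfProfiles
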